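import Literature.MathematicalPhysics.QuantumLattice.WilsonFeynmanHellmann
import HarnessLib

/-!
# Smoothness in the coupling of torus Wilson expectations

For Wilson's lattice gauge theory on the discrete torus `(ℤ/Lℤ)^d` with compact gauge group `G`
and a continuous matrix representation `ρ`, the finite-volume expectation
`β ↦ ⟨F⟩_β = ∫ F d(wilsonMeasure ρ β)` of every bounded (product-Haar-a.e. strongly measurable)
observable `F` is infinitely differentiable in the inverse coupling `β` on all of `ℝ`
(`contDiff_integral_wilsonMeasure`, `contDiff_infty_integral_wilsonMeasure`), and so is every
finite-volume covariance / connected correlation `⟨F G⟩_β − ⟨F⟩_β ⟨G⟩_β`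
(`contDiff_covariance_wilsonMeasure`).

Proof: iterate the Feynman–Hellmann / fluctuation–response identity of the tree
(`hasDerivAt_integral_wilsonMeasure`: `d/dβ ⟨F⟩_β = −(⟨F S_W⟩_β − ⟨F⟩_β⟨S_W⟩_β)`): the derivative of
the expectation of a bounded observable is a polynomial in expectations of bounded observables
(`F`, `F · S_W`, `S_W` — the Wilson action `S_W` is bounded on the compact configuration space,
`exists_abs_wilsonAction_le`), so `C^n` for all bounded observables implies `C^{n+1}` for all
bounded observables (`contDiff_succ_iff_deriv`), by induction on `n`.
(Real-analyticity in `β` also holds — the partition function is an entire function of `β` — but is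
not recorded here.)

Source: standard; E. Seiler, *Gauge Theories as a Problem of Constructive Quantum Field Theory and
Statistical Mechanics*, LNP 159 (1982), Ch. 1–2 (finite-volume expectations are ratios of entire
functions of `β`); B. Simon, *The Statistical Mechanics of Lattice Gases* I (1993), §II.1.
Deliberately NOT here: analyticity, bounds on the derivatives uniform in the volume, infinite volume.
-/

noncomputable section

open MeasureTheory ProbabilityTheory Filter Topology Real
open scoped ContDiff
open Literature.MathematicalPhysics.QuantumFieldTheory

namespace Literature.MathematicalPhysics.QuantumLattice

section Wilson

variable {d L N : ℕ} {G : Type*} [Group G] [TopologicalSpace G] [IsTopologicalGroup G]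
  [CompactSpace G] [MeasurableSpace G] [BorelSpace G] [SecondCountableTopology G] [NeZero L]
  {ρ : G →* Matrix (Fin N) (Fin N) ℂ}

/-- **Torus Wilson expectations of bounded observables are `C^n` in the coupling, every `n : ℕ`.**
For a continuous representation `ρ`, a product-Haar-a.e. strongly measurable observable `F` with
`‖F‖ ≤ C` a.e., and every `n : ℕ`, the map `β ↦ ∫ F d(wilsonMeasure ρ β)` is `C^n` on `ℝ`.
Induction on `n` over ALL bounded observables simultaneously, the derivative being
`−(⟨F S_W⟩ − ⟨F⟩⟨S_W⟩)` (Feynman–Hellmann, `hasDerivAt_integral_wilsonMeasure`) with `S_W` bounded.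
(Seiler, LNP 159, Ch. 1–2; Simon, Lattice Gases I, §II.1.) [folklore] -/
theorem contDiff_integral_wilsonMeasure (hρ : Continuous ρ) (n : ℕ) :
    ∀ {F : GaugeConfig d L G → ℝ} {C : ℝ},
      AEStronglyMeasurable F (Measure.pi fun _ : Edge d L => haarProbability G) →
      (∀ᵐ U ∂(Measure.pi fun _ : Edge d L => haarProbability G), ‖F U‖ ≤ C) →
        ContDiff ℝ n (fun b : ℝ => ∫ U, F U ∂(wilsonMeasure (d := d) (L := L) ρ b)) := by
  induction n with
  | zero =>
    intro F C hF hC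
    exact contDiff_zero.2 (continuous_iff_continuousAt.2 fun β =>
      (hasDerivAt_integral_wilsonMeasure hρ hF hC β).continuousAt)
  | succ n ih =>
    intro F C hF hC
    obtain ⟨B, hB⟩ := exists_abs_wilsonAction_le (d := d) (L := L) ρ hρ
    have hS : AEStronglyMeasurable (fun U : GaugeConfig d L G => wilsonAction ρ U)
        (Measure.pi fun _ : Edge d L => haarProbability G) :=
      (measurable_wilsonAction ρ hρ).aestronglyMeasurable
    have hSB : ∀ᵐ U ∂(Measure.pi fun _ : Edge d L => haarProbability G),
        ‖wilsonAction ρ U‖ ≤ B :=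
      ae_of_all _ fun U => by rw [Real.norm_eq_abs]; exact hB U
    have hFS : AEStronglyMeasurable (fun U : GaugeConfig d L G => F U * wilsonAction ρ U)
        (Measure.pi fun _ : Edge d L => haarProbability G) := hF.mul hS
    have hFSB : ∀ᵐ U ∂(Measure.pi fun _ : Edge d L => haarProbability G),
        ‖F U * wilsonAction ρ U‖ ≤ C * B := by
      filter_upwards [hC] with U hU
      rw [norm_mul, Real.norm_eq_abs (wilsonAction ρ U)]
      exact mul_le_mul hU (hB U) (abs_nonneg _) ((norm_nonneg _).trans hU)
    have hderiv : deriv (fun b : ℝ => ∫ U, F U ∂(wilsonMeasure (d := d) (L := L) ρ b)) =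
        fun β => -((∫ U, F U * wilsonAction ρ U ∂(wilsonMeasure (d := d) (L := L) ρ β)) -
          (∫ U, F U ∂(wilsonMeasure (d := d) (L := L) ρ β)) *
            ∫ U, wilsonAction ρ U ∂(wilsonMeasure (d := d) (L := L) ρ β)) :=
      funext fun β => (hasDerivAt_integral_wilsonMeasure hρ hF hC β).deriv
    rw [Nat.cast_succ, contDiff_succ_iff_deriv]
    refine ⟨fun β => (hasDerivAt_integral_wilsonMeasure hρ hF hC β).differentiableAt, ?_, ?_⟩
    · intro h
      exact absurd h (WithTop.natCast_ne_top n)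
    · rw [hderiv]
      exact ((ih hFS hFSB).sub ((ih hF hC).mul (ih hS hSB))).neg

/-- **Torus Wilson expectations of bounded observables are `C^∞` in the coupling.**
(Seiler, LNP 159, Ch. 1–2; Simon, Lattice Gases I, §II.1.) [folklore] -/
theorem contDiff_infty_integral_wilsonMeasure (hρ : Continuous ρ) {F : GaugeConfig d L G → ℝ}
    {C : ℝ} (hF : AEStronglyMeasurable F (Measure.pi fun _ : Edge d L => haarProbability G))
    (hC : ∀ᵐ U ∂(Measure.pi fun _ : Edge d L => haarProbability G), ‖F U‖ ≤ C) :
    ContDiff ℝ ∞ (fun b : ℝ => ∫ U, F U ∂(wilsonMeasure (d := d) (L := L) ρ b)) :=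
  contDiff_infty.2 fun n => contDiff_integral_wilsonMeasure hρ n hF hC

/-- **Finite-volume connected correlations are `C^n` in the coupling**: for bounded a.e. strongly
measurable `F, G` and every `n : ℕ`, `β ↦ ⟨F G⟩_β − ⟨F⟩_β⟨G⟩_β` is `C^n` on `ℝ`.
(Seiler, LNP 159, Ch. 1–2.) [folklore] -/
theorem contDiff_covariance_wilsonMeasure (hρ : Continuous ρ) (n : ℕ)
    {F G' : GaugeConfig d L G → ℝ} {C D : ℝ}
    (hF : AEStronglyMeasurable F (Measure.pi fun _ : Edge d L => haarProbability G))
    (hC : ∀ᵐ U ∂(Measure.pi fun _ : Edge d L => haarProbability G), ‖F U‖ ≤ C)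
    (hG : AEStronglyMeasurable G' (Measure.pi fun _ : Edge d L => haarProbability G))
    (hD : ∀ᵐ U ∂(Measure.pi fun _ : Edge d L => haarProbability G), ‖G' U‖ ≤ D) :
    ContDiff ℝ n (fun b : ℝ => (∫ U, F U * G' U ∂(wilsonMeasure (d := d) (L := L) ρ b)) -
      (∫ U, F U ∂(wilsonMeasure (d := d) (L := L) ρ b)) *
        ∫ U, G' U ∂(wilsonMeasure (d := d) (L := L) ρ b)) := by
  have hFG : AEStronglyMeasurable (fun U => F U * G' U)
      (Measure.pi fun _ : Edge d L => haarProbability G) := hF.mul hG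
  have hFGB : ∀ᵐ U ∂(Measure.pi fun _ : Edge d L => haarProbability G), ‖F U * G' U‖ ≤ C * D := by
    filter_upwards [hC, hD] with U hU hU'
    rw [norm_mul]
    exact mul_le_mul hU hU' (norm_nonneg _) ((norm_nonneg _).trans hU)
  exact (contDiff_integral_wilsonMeasure hρ n hFG hFGB).sub
    ((contDiff_integral_wilsonMeasure hρ n hF hC).mul (contDiff_integral_wilsonMeasure hρ n hG hD))

end Wilson

end Literature.MathematicalPhysics.QuantumLattice

end
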